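/-
Copyright (c) 2026 the pub-hodgecm-mathlib formalisation cell (harness21).  Prover seat hodgecm-mathlib-R90-C10-p03 (g0) (valve hand to L1),
Track B «K2-LIT» ∕ hLiu418 #184♮ = `stmt-HodgeConjecture-24832`, socket #41 K1-b♮ ∕ (P-dec) organ — brick (ρ6a)(ii) part (B-ii) «entry monotonicity»
(LEAD F0P6-plan (g14) BATCH #172 (1)–(3); K2Liu-p14 (g4) WORD #4; my census 2026-09-04T23:43Z∕23:46Z).
-/
import Summits.HodgeConjecture.HodgeConjecture.Theorems.K2LiuAdelicHeightGLVsVecHeight   -- ★ K2Liu-p04: `adelicHeightGL_le_vecHeight` (`‖g‖ ≤ h(1, g, g⁻¹)`), `isHeightFinite_one_entries_inv`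
import Mathlib.NumberTheory.NumberField.InfinitePlace.Basic
import HarnessLib

/-!
# K2_Liu road (hLiu418), (P-dec) organ, brick (B-ii): THE HEIGHT OF A `GL₂` MATRIX WITH ENTRIES IN `{0, 1, ± w_k / w_i}` IS BOUNDED BY THE GODEMENT–GARRETT
# HEIGHT OF THE PRINCIPAL VECTOR `w` — `‖γ[w]_𝔸‖ ≤ 3^{[L:ℚ]} · h(w)`

Cell `pub/hodgecm-mathlib` (D-0151), Track B.  Lane `--kind proof --supports stmt-HodgeConjecture-24832 --as helper` (count-neutral; THEOREMS ONLY: no `def`,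
no `instance`, no notation, no named-fact hypothesis, no `sorry`).

THE CHAIN (LEAD BATCH #172): p14's (P-dec) letter `hΛγ : ‖Λ(γ[w])‖ ≤ C · Height.mulHeight w ^ k` = (B-iii) `‖Λ g‖ ≤ C‖g‖²` (LH4-p10∕next hand) ∘ (B-ii) THIS FILE
`‖γ[w]_𝔸‖ ≤ 3^{[L:ℚ]} · h(principalVec w)` ∘ (B-i) `h(principalVec w) ≤ C · mulHeight w ^ k` (F0P2-p09), for the normalised row section `γ[w]` of ★ p863259
`K2LiuRankOneRowSection.exists_normalised_rowSection` (entries of `γ[w]`, `γ[w]⁻¹` ∈ `{0, 1, ± w_k / w_i}`, `w_i ≠ 0`).  Here, HYPOTHESIS-FIRST on that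
entry control (so any section with it qualifies):
* §1 GENERIC MONOTONICITY over ★ `Literature/NumberTheory/Automorphic/AdelicVectorHeight` (`K` any number field): if every coordinate of `x : ι → 𝔸_K` is `0` or
  `± u_j` for some coordinate of `u : κ → 𝔸_K`, then `h_v(x) ≤ h_v(u)` at every finite place (sup norms, ultrametric-free: just `‖−a‖ = ‖a‖`),
  `‖x‖_w ≤ √|ι| · ‖u‖_w` at every infinite place (Euclidean norms: each coordinate of `x` is `≤ ‖u‖_w`), hence
  **`vecHeight_le_of_coords` : `h(x) ≤ (√|ι|)^{[K:ℚ]} · h(u)`** for height-finite `x`, `u` (`Σ_w mult w = [K:ℚ]`, Mathlib `sum_mult_eq`).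
* §2 **`adelicHeightGL_map_le_vecHeight_principalVec_of_entries`** — for `w : Fin 2 → L`, `w i ≠ 0`, and `g : GL (Fin 2) L` whose entries and whose inverse's
  entries are each `0`, `1`, `(w i)⁻¹ * w k` or `−((w i)⁻¹ * w k)` (★ p863259 clause (b) VERBATIM): `adelicHeightGL 2 L (g_𝔸) ≤ (√9)^{[L:ℚ]} · vecHeight L (principalVec L w)`
  — ★ `adelicHeightGL_le_vecHeight` (`‖g_𝔸‖ ≤ h(1, g, g⁻¹)`, 9 coordinates), §1 against `u := principalVec ((w i)⁻¹ • w)` (its `i`-th coordinate is `1`), and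
  `h((w i)⁻¹ • w) = h(w)` (★ `vecHeight_smul_algebraMap`, the product formula); `∃ C` packaging `exists_adelicHeightGL_rowSection_le`.
HONEST LABEL: HC_CM is proved only modulo the 7 printed citations (2 remaining named inputs: hLiu418 = `stmt-HodgeConjecture-24832`, h413 =
`stmt-HodgeConjecture-24833`) until rung 0 closes; this helper closes nothing and moves no counter.
References: [BorelJacquet1979] §1.2 (heights on `GL_n(𝔸)`); [Garrett2018] §2.2 (Godement–Garrett heights, product formula); [MoeglinWaldspurger1995] I.2.2.
-/

set_option autoImplicit false
set_option linter.dupNamespace false -- the mandated namespace repeats `HodgeConjecture.HodgeConjecture`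

noncomputable section

open scoped NNReal MatrixGroups Classical
open NumberField IsDedekindDomain

namespace Summit.HodgeConjecture.HodgeConjecture.Cruxes.HLiu418.K2LiuRowSectionHeightLeVecHeight

open Literature.NumberTheory.Automorphic
open Summit.HodgeConjecture.HodgeConjecture.Cruxes.HLiu418.K2LiuAdelicHeightGLVsVecHeight (adelicHeightGL_le_vecHeight isHeightFinite_one_entries_inv)

/-! ## §1 Generic monotonicity of the Godement–Garrett height -/

section Mono

variable {K : Type} [Field K] [NumberField K] {ι κ : Type*} [Fintype ι] [Fintype κ]

/-- `h_v(x) ≤ h_v(u)` at a finite place when every coordinate of `x` is `0` or `± u_j`. [cite: Garrett2018, §2.2 (PDF p. 81)] -/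
theorem vecFinHeight_le_of_coords {x : ι → AdeleRing (𝓞 K) K} {u : κ → AdeleRing (𝓞 K) K}
    (h : ∀ i, x i = 0 ∨ ∃ j, x i = u j ∨ x i = -u j) (v : HeightOneSpectrum (𝓞 K)) :
    vecFinHeight K v x ≤ vecFinHeight K v u := by
  refine vecFinHeight_le fun i => ?_
  rcases h i with h0 | ⟨j, hj | hj⟩
  · rw [h0, AdeleRing.zero_snd_apply, nnnorm_zero]
    exact bot_le
  · rw [hj]
    exact nnnorm_snd_apply_le_vecFinHeight v u j
  · rw [hj, show (-(u j)).2 v = -((u j).2 v) from rfl, nnnorm_neg]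
    exact nnnorm_snd_apply_le_vecFinHeight v u j

/-- `‖x‖_w ≤ √|ι| · ‖u‖_w` at an infinite place when every coordinate of `x` is `0` or `± u_j` (Euclidean norms: each `|x_i|_w ≤ ‖u‖_w`).
[cite: Garrett2018, §2.2 (PDF p. 81)] -/
theorem vecArchNorm_le_of_coords {x : ι → AdeleRing (𝓞 K) K} {u : κ → AdeleRing (𝓞 K) K}
    (h : ∀ i, x i = 0 ∨ ∃ j, x i = u j ∨ x i = -u j) (w : InfinitePlace K) :
    vecArchNorm K w x ≤ NNReal.sqrt (Fintype.card ι) * vecArchNorm K w u := by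
  have hcoord : ∀ i, ‖(x i).1 w‖₊ ≤ vecArchNorm K w u := by
    intro i
    rcases h i with h0 | ⟨j, hj | hj⟩
    · rw [h0, AdeleRing.zero_fst_apply, nnnorm_zero]
      exact bot_le
    · rw [hj]
      exact nnnorm_fst_apply_le_vecArchNorm w u j
    · rw [hj, show (-(u j)).1 w = -((u j).1 w) from rfl, nnnorm_neg]
      exact nnnorm_fst_apply_le_vecArchNorm w u j
  have hsum : ∑ i, ‖(x i).1 w‖₊ ^ 2 ≤ (Fintype.card ι : ℝ≥0) * vecArchNorm K w u ^ 2 := by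
    calc ∑ i, ‖(x i).1 w‖₊ ^ 2 ≤ ∑ _i : ι, vecArchNorm K w u ^ 2 :=
          Finset.sum_le_sum fun i _ => pow_le_pow_left' (hcoord i) 2
      _ = (Fintype.card ι : ℝ≥0) * vecArchNorm K w u ^ 2 := by
          rw [Finset.sum_const, Finset.card_univ, nsmul_eq_mul]
  calc vecArchNorm K w x = NNReal.sqrt (∑ i, ‖(x i).1 w‖₊ ^ 2) := rfl
    _ ≤ NNReal.sqrt ((Fintype.card ι : ℝ≥0) * vecArchNorm K w u ^ 2) := NNReal.sqrt_le_sqrt.2 hsum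
    _ = NNReal.sqrt (Fintype.card ι) * vecArchNorm K w u := by rw [NNReal.sqrt_mul, NNReal.sqrt_sq]

/-- **`h(x) ≤ (√|ι|)^{[K:ℚ]} · h(u)`** for height-finite adelic vectors when every coordinate of `x` is `0` or `± u_j` (finite places: sup norms; infinite
places: Euclidean norms, `Σ_w mult w = [K:ℚ]`). [cite: Garrett2018, §2.2 (PDF p. 81)] [cite: BorelJacquet1979, §1.2] -/
theorem vecHeight_le_of_coords {x : ι → AdeleRing (𝓞 K) K} {u : κ → AdeleRing (𝓞 K) K}
    (h : ∀ i, x i = 0 ∨ ∃ j, x i = u j ∨ x i = -u j) (hx : IsHeightFinite K x) (hu : IsHeightFinite K u) :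
    vecHeight K x ≤ NNReal.sqrt (Fintype.card ι) ^ Module.finrank ℚ K * vecHeight K u := by
  have harch : ∏ w : InfinitePlace K, vecArchNorm K w x ^ w.mult ≤
      NNReal.sqrt (Fintype.card ι) ^ Module.finrank ℚ K * ∏ w : InfinitePlace K, vecArchNorm K w u ^ w.mult := by
    calc ∏ w : InfinitePlace K, vecArchNorm K w x ^ w.mult
        ≤ ∏ w : InfinitePlace K, (NNReal.sqrt (Fintype.card ι) * vecArchNorm K w u) ^ w.mult :=
          Finset.prod_le_prod' fun w _ => pow_le_pow_left' (vecArchNorm_le_of_coords h w) _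
      _ = NNReal.sqrt (Fintype.card ι) ^ Module.finrank ℚ K * ∏ w : InfinitePlace K, vecArchNorm K w u ^ w.mult := by
          simp_rw [mul_pow, Finset.prod_mul_distrib, Finset.prod_pow_eq_pow_sum, InfinitePlace.sum_mult_eq]
  have hfin : ∏ᶠ v, vecFinHeight K v x ≤ ∏ᶠ v, vecFinHeight K v u :=
    finprod_le_finprod' hx hu fun v => vecFinHeight_le_of_coords h v
  calc vecHeight K x = (∏ w : InfinitePlace K, vecArchNorm K w x ^ w.mult) * ∏ᶠ v, vecFinHeight K v x := rfl
    _ ≤ (NNReal.sqrt (Fintype.card ι) ^ Module.finrank ℚ K * ∏ w : InfinitePlace K, vecArchNorm K w u ^ w.mult) *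
          ∏ᶠ v, vecFinHeight K v u := mul_le_mul' harch hfin
    _ = NNReal.sqrt (Fintype.card ι) ^ Module.finrank ℚ K * vecHeight K u := by rw [vecHeight, mul_assoc]

omit [Fintype κ] in
/-- `principalVec (c • ξ) = (c)_𝔸 • principalVec ξ`. [folklore] -/
theorem principalVec_smul (c : K) (ξ : κ → K) :
    principalVec K (c • ξ) = algebraMap K (AdeleRing (𝓞 K) K) c • principalVec K ξ := by
  funext j
  simp only [principalVec_apply, Pi.smul_apply, smul_eq_mul, map_mul]

/-- **`h((c • ξ)_𝔸) = h(ξ_𝔸)` for `c ≠ 0`** (the product formula, ★ `vecHeight_smul_algebraMap`). [cite: Garrett2018, §2.2 (PDF p. 81)] -/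
theorem vecHeight_principalVec_smul {c : K} (hc : c ≠ 0) {ξ : κ → K} (hξ : ξ ≠ 0) :
    vecHeight K (principalVec K (c • ξ)) = vecHeight K (principalVec K ξ) := by
  rw [principalVec_smul]
  exact vecHeight_smul_algebraMap (isHeightFinite_principalVec hξ) (Units.mk0 c hc)

end Mono

/-! ## §2 The height of a matrix with entries in `{0, 1, ± w_k / w_i}` -/

section RowSection

variable (L : Type) [Field L] [NumberField L]

/-- **`‖g_𝔸‖ ≤ (√9)^{[L:ℚ]} · h(w_𝔸)`** for `g ∈ GL₂(L)` whose entries and whose inverse's entries are each `0`, `1`, `w_k / w_i` or `−(w_k / w_i)` (`w_i ≠ 0`;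
the entry control of ★ `K2LiuRankOneRowSection.exists_normalised_rowSection`, clause (b), VERBATIM): ★ `adelicHeightGL_le_vecHeight` bounds `‖g_𝔸‖` by the height
of the 9-coordinate vector `(1, g, g⁻¹)`, each coordinate of which is `0` or `±` a coordinate of `u = ((w i)⁻¹ • w)_𝔸` (whose `i`-th coordinate is `1`), so
§1 gives `≤ (√9)^{[L:ℚ]} h(u) = (√9)^{[L:ℚ]} h(w_𝔸)` by the product formula. [cite: BorelJacquet1979, §1.2] [cite: Garrett2018, §2.2 (PDF p. 81)] -/
theorem adelicHeightGL_map_le_vecHeight_principalVec_of_entries (w : Fin 2 → L) (i : Fin 2) (hi : w i ≠ 0) (g : GL (Fin 2) L)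
    (hent : ∀ a b : Fin 2,
      (∃ k : Fin 2, (g : Matrix (Fin 2) (Fin 2) L) a b = 0 ∨ (g : Matrix (Fin 2) (Fin 2) L) a b = 1 ∨
        (g : Matrix (Fin 2) (Fin 2) L) a b = (w i)⁻¹ * w k ∨ (g : Matrix (Fin 2) (Fin 2) L) a b = -((w i)⁻¹ * w k)) ∧
      (∃ k : Fin 2, ((g⁻¹ : GL (Fin 2) L) : Matrix (Fin 2) (Fin 2) L) a b = 0 ∨ ((g⁻¹ : GL (Fin 2) L) : Matrix (Fin 2) (Fin 2) L) a b = 1 ∨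
        ((g⁻¹ : GL (Fin 2) L) : Matrix (Fin 2) (Fin 2) L) a b = (w i)⁻¹ * w k ∨
        ((g⁻¹ : GL (Fin 2) L) : Matrix (Fin 2) (Fin 2) L) a b = -((w i)⁻¹ * w k))) :
    adelicHeightGL 2 L (Matrix.GeneralLinearGroup.map (algebraMap L (AdeleRing (𝓞 L) L)) g) ≤
      ((NNReal.sqrt 9 ^ Module.finrank ℚ L * vecHeight L (principalVec L w) : ℝ≥0) : ℝ) := by
  have hw : w ≠ 0 := fun h => hi (by rw [h]; rfl)
  set G : GL (Fin 2) (AdeleRing (𝓞 L) L) := Matrix.GeneralLinearGroup.map (algebraMap L (AdeleRing (𝓞 L) L)) g with hG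
  -- the entries of `g_𝔸` and `g_𝔸⁻¹` are the images of those of `g`, `g⁻¹`
  have hGe : ∀ a b, (G : Matrix (Fin 2) (Fin 2) (AdeleRing (𝓞 L) L)) a b = algebraMap L (AdeleRing (𝓞 L) L) ((g : Matrix (Fin 2) (Fin 2) L) a b) :=
    fun a b => rfl
  have hGi : ∀ a b, ((G⁻¹ : GL (Fin 2) (AdeleRing (𝓞 L) L)) : Matrix (Fin 2) (Fin 2) (AdeleRing (𝓞 L) L)) a b =
      algebraMap L (AdeleRing (𝓞 L) L) (((g⁻¹ : GL (Fin 2) L) : Matrix (Fin 2) (Fin 2) L) a b) := fun a b => by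
    rw [hG, ← map_inv]; rfl
  -- the comparison vector `u = ((w i)⁻¹ • w)_𝔸`, with `u i = 1`
  set u : Fin 2 → AdeleRing (𝓞 L) L := principalVec L ((w i)⁻¹ • w) with hu
  have hu1 : u i = 1 := by
    rw [hu, principalVec_apply, Pi.smul_apply, smul_eq_mul, inv_mul_cancel₀ hi, map_one]
  have huk : ∀ k, u k = algebraMap L (AdeleRing (𝓞 L) L) ((w i)⁻¹ * w k) := fun k => rfl
  -- every coordinate of `(1, g_𝔸, g_𝔸⁻¹)` is `0` or `± u_k`
  have hcoords : ∀ c : Option (Fin 2 × Fin 2) ⊕ (Fin 2 × Fin 2),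
      (Sum.elim (fun o : Option (Fin 2 × Fin 2) => o.elim 1 fun ij => (G : Matrix (Fin 2) (Fin 2) (AdeleRing (𝓞 L) L)) ij.1 ij.2)
          (fun ik : Fin 2 × Fin 2 => ((G⁻¹ : GL (Fin 2) (AdeleRing (𝓞 L) L)) : Matrix (Fin 2) (Fin 2) (AdeleRing (𝓞 L) L)) ik.1 ik.2) c :
            AdeleRing (𝓞 L) L) = 0 ∨
        ∃ j, (Sum.elim (fun o : Option (Fin 2 × Fin 2) => o.elim 1 fun ij => (G : Matrix (Fin 2) (Fin 2) (AdeleRing (𝓞 L) L)) ij.1 ij.2)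
            (fun ik : Fin 2 × Fin 2 => ((G⁻¹ : GL (Fin 2) (AdeleRing (𝓞 L) L)) : Matrix (Fin 2) (Fin 2) (AdeleRing (𝓞 L) L)) ik.1 ik.2) c :
              AdeleRing (𝓞 L) L) = u j ∨
          (Sum.elim (fun o : Option (Fin 2 × Fin 2) => o.elim 1 fun ij => (G : Matrix (Fin 2) (Fin 2) (AdeleRing (𝓞 L) L)) ij.1 ij.2)
            (fun ik : Fin 2 × Fin 2 => ((G⁻¹ : GL (Fin 2) (AdeleRing (𝓞 L) L)) : Matrix (Fin 2) (Fin 2) (AdeleRing (𝓞 L) L)) ik.1 ik.2) c :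
              AdeleRing (𝓞 L) L) = -u j := by
    rintro ((_ | ⟨a, b⟩) | ⟨a, b⟩)
    · simp only [Sum.elim_inl, Option.elim_none]
      exact Or.inr ⟨i, Or.inl hu1.symm⟩
    · simp only [Sum.elim_inl, Option.elim_some]
      rw [hGe]
      obtain ⟨k, h | h | h | h⟩ := (hent a b).1
      · exact Or.inl (by rw [h, map_zero])
      · exact Or.inr ⟨i, Or.inl (by rw [h, map_one, hu1])⟩
      · exact Or.inr ⟨k, Or.inl (by rw [h, huk])⟩
      · exact Or.inr ⟨k, Or.inr (by rw [h, map_neg, huk])⟩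
    · simp only [Sum.elim_inr]
      rw [hGi]
      obtain ⟨k, h | h | h | h⟩ := (hent a b).2
      · exact Or.inl (by rw [h, map_zero])
      · exact Or.inr ⟨i, Or.inl (by rw [h, map_one, hu1])⟩
      · exact Or.inr ⟨k, Or.inl (by rw [h, huk])⟩
      · exact Or.inr ⟨k, Or.inr (by rw [h, map_neg, huk])⟩
  have hwi : (w i)⁻¹ • w ≠ 0 := by
    intro h0
    have := congrFun h0 i
    rw [Pi.smul_apply, smul_eq_mul, inv_mul_cancel₀ hi, Pi.zero_apply] at this
    exact one_ne_zero this
  have hcard : (Fintype.card (Option (Fin 2 × Fin 2) ⊕ (Fin 2 × Fin 2)) : ℝ≥0) = 9 := by norm_num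
  have h1 := adelicHeightGL_le_vecHeight (K := L) G
  have h2 := vecHeight_le_of_coords hcoords (isHeightFinite_one_entries_inv (K := L) G) (isHeightFinite_principalVec hwi)
  rw [hcard] at h2
  have h3 : vecHeight L u = vecHeight L (principalVec L w) := vecHeight_principalVec_smul (inv_ne_zero hi) hw
  rw [h3] at h2
  exact h1.trans (by exact_mod_cast h2)

/-- **`∃ C, ‖g_𝔸‖ ≤ C · h(w_𝔸)`** — the `∃`-packaging (B-ii) hands to (P-dec): ONE constant `C = (√9)^{[L:ℚ]}` for all `w`, `i`, `g` with the entry control.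
[cite: BorelJacquet1979, §1.2] [cite: Garrett2018, §2.2 (PDF p. 81)] -/
theorem exists_adelicHeightGL_rowSection_le :
    ∃ C : ℝ, 0 ≤ C ∧ ∀ (w : Fin 2 → L) (i : Fin 2), w i ≠ 0 → ∀ g : GL (Fin 2) L,
      (∀ a b : Fin 2,
        (∃ k : Fin 2, (g : Matrix (Fin 2) (Fin 2) L) a b = 0 ∨ (g : Matrix (Fin 2) (Fin 2) L) a b = 1 ∨
          (g : Matrix (Fin 2) (Fin 2) L) a b = (w i)⁻¹ * w k ∨ (g : Matrix (Fin 2) (Fin 2) L) a b = -((w i)⁻¹ * w k)) ∧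
        (∃ k : Fin 2, ((g⁻¹ : GL (Fin 2) L) : Matrix (Fin 2) (Fin 2) L) a b = 0 ∨ ((g⁻¹ : GL (Fin 2) L) : Matrix (Fin 2) (Fin 2) L) a b = 1 ∨
          ((g⁻¹ : GL (Fin 2) L) : Matrix (Fin 2) (Fin 2) L) a b = (w i)⁻¹ * w k ∨
          ((g⁻¹ : GL (Fin 2) L) : Matrix (Fin 2) (Fin 2) L) a b = -((w i)⁻¹ * w k))) →
      adelicHeightGL 2 L (Matrix.GeneralLinearGroup.map (algebraMap L (AdeleRing (𝓞 L) L)) g) ≤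
        C * ((vecHeight L (principalVec L w) : ℝ≥0) : ℝ) :=
  ⟨((NNReal.sqrt 9 ^ Module.finrank ℚ L : ℝ≥0) : ℝ), NNReal.coe_nonneg _, fun w i hi g hent => by
    have h := adelicHeightGL_map_le_vecHeight_principalVec_of_entries L w i hi g hent
    rwa [NNReal.coe_mul] at h⟩

end RowSection

end Summit.HodgeConjecture.HodgeConjecture.Cruxes.HLiu418.K2LiuRowSectionHeightLeVecHeight

end
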